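import Mathlib
import HarnessLib

/-!
# Bus boundary-layer storage of the lossy structure-preserving model: exact derivative, antisymmetric drop-out,
# Laplacian-plus-rowsum split, COI moment, series / path grounding (matrix-free grounded-Laplacian lower bounds)

Venture GRIDFUSION, G2-SCALE cell; card «idea-1 (cycle 3) / bus-boundary-layer-lossy-lyapunov» (HOME/IDEAS-G2.md § l.549;
crit-1 GRADE PASS · NEW-MECHANISM, STATUS 2026-08-28T20:37:48Z / 20:38:05Z, first rungs P1/P2 «typing-only, generic,
T-row-eligible»); the planner's scratch `HOME/idea-1/c3/BoundaryLayerSketch.lean` (sha16 8a3df3d140a77fd6, REV 6, 168 lines,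
`import Mathlib` only, crit-1 g2 independent farm check rc 0 / 0 warnings / 0 sorry STATUS l.10675) filed VERBATIM in content by the
cell's Lean-lane seat gridfusion-sos-5 (g11); namespace renamed from `…Lyapunov.BoundaryLayerSketch` to `…Lyapunov.BoundaryLayer`.
0 kit, 0 facts; pure linear algebra / calculus over an arbitrary finite index type.

WHAT IT SAYS (the algebra behind the card's bus boundary-layer storage `W = γ Σ_b F_b²/(2 D_b)` of the LOSSY structure-preserving
DAE, MODELLED column vocabulary only — the card's rows R1–R5 and every instance number are NOT here):

* `dotProduct_mulVec_of_antisymm`, `dotProduct_mulVec_eq_symmPart` : an antisymmetric matrix contributes nothing to a quadratic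
  form — in `Ẇ = −γ νᵀ S_{b·} θ̇` the loss circulation `K = antisym(S)` drops out of the bus–bus block;
* `dotProduct_mulVec_eq_rowsum_sub_edges` (P1): the Laplacian-plus-rowsum split `xᵀAx = Σᵢ(Σⱼ Aᵢⱼ)xᵢ² − ½ΣᵢΣⱼ Aᵢⱼ(xᵢ − xⱼ)²` of a
  symmetric form (the edge form is the tree's `Lyapunov.EdgeSandwich.lapForm`, `LaplacianEdgeSandwich.lean`, cited by name only);
* `W`, `hasDerivAt_W`, `derivW_eq_neg_form` : the EXACT chain-rule derivative of `W` along any differentiable motion and its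
  bilinear-form reading with `Ḟ = −S θ̇`, `ν_b = F_b/D_b`;
* `coi_moment_zero` : `Σ_g M_g y_g = 0` for COI-relative coordinates (kills the damping/cross mixed term under a uniform rate);
* `series_grounding`, `pathGround`, `pathGround_pos`, `path_grounding` (P2, path case): the series rule
  `c(x−y)² + a y² ≥ (ca/(c+a))x²` and the induced matrix-free lower bound `g·x₀² + Σ c(i+1)(x(i+1) − x(i))² ≥ a(n)·x(n)²` for a
  grounded path Laplacian (private-fraction grounding recursion).
Nothing here certifies a real grid.
-/

namespace Summit.Ventures.GridStability.Lyapunov.BoundaryLayer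


open Finset Matrix

variable {ι : Type*} [Fintype ι] [DecidableEq ι]

/-- The bus boundary-layer storage `W = γ Σ_b F_b² / (2 D_b)`. [folklore] -/
noncomputable def W (γ : ℝ) (D F : ι → ℝ) : ℝ := γ * ∑ b, F b ^ 2 / (2 * D b)

omit [DecidableEq ι] in
/-- An antisymmetric matrix contributes nothing to a quadratic form. [folklore] -/
theorem dotProduct_mulVec_of_antisymm (K : Matrix ι ι ℝ) (hK : Kᵀ = -K) (v : ι → ℝ) :
    v ⬝ᵥ (K *ᵥ v) = 0 := by
  have h : v ⬝ᵥ (K *ᵥ v) = -(v ⬝ᵥ (K *ᵥ v)) := by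
    calc v ⬝ᵥ (K *ᵥ v) = (v ᵥ* K) ⬝ᵥ v := dotProduct_mulVec v K v
      _ = (Kᵀ *ᵥ v) ⬝ᵥ v := by rw [mulVec_transpose]
      _ = ((-K) *ᵥ v) ⬝ᵥ v := by rw [hK]
      _ = -(v ⬝ᵥ (K *ᵥ v)) := by rw [neg_mulVec, neg_dotProduct, dotProduct_comm]
  linarith

omit [DecidableEq ι] in
/-- Quadratic forms only see the symmetric part: `vᵀ S v = vᵀ ((S + Sᵀ)/2) v`. [folklore] -/
theorem dotProduct_mulVec_eq_symmPart (S : Matrix ι ι ℝ) (v : ι → ℝ) :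
    v ⬝ᵥ (S *ᵥ v) = v ⬝ᵥ (((1 / 2 : ℝ) • (S + Sᵀ)) *ᵥ v) := by
  have hK : ((1 / 2 : ℝ) • (S - Sᵀ))ᵀ = -((1 / 2 : ℝ) • (S - Sᵀ)) := by
    rw [transpose_smul, transpose_sub, transpose_transpose, ← smul_neg, neg_sub]
  have h0 := dotProduct_mulVec_of_antisymm ((1 / 2 : ℝ) • (S - Sᵀ)) hK v
  have hsplit : S = (1 / 2 : ℝ) • (S + Sᵀ) + (1 / 2 : ℝ) • (S - Sᵀ) := by
    rw [← smul_add]; rw [add_add_sub_cancel, ← two_smul ℝ S, smul_smul]; norm_num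
  conv_lhs => rw [hsplit]
  rw [add_mulVec, dotProduct_add, h0, add_zero]

omit [DecidableEq ι] in
/-- P1 completion (crit-1 GRADE (2/2), first rung): the LAPLACIAN-PLUS-ROWSUM split of a symmetric
quadratic form, `xᵀAx = Σ_i (Σ_j A_ij) x_i² − ½ Σ_i Σ_j A_ij (x_i − x_j)²`.  Applied to
`A = ½(S_bb + S_bbᵀ)` (the symmetric part of the gauged bus block) it is the card's reading of the
boundary-layer dissipation `νᵀS_bbν = Σ_{bus edges} c_e (ν_i − ν_j)² + Σ_b r_b ν_b²` with
`−A_ij = c_e(θ) ≥ 0` on the window and row sums `r_b` = groundings through `x′_d` plus the gauge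
drift `½(J(θ)ᵀλ)_b` (zero at `θ*`).  The edge form is the tree's
`Lyapunov.EdgeSandwich.lapForm` (LaplacianEdgeSandwich, p664471), cited by name only here. [folklore] -/
theorem dotProduct_mulVec_eq_rowsum_sub_edges (A : Matrix ι ι ℝ) (hA : A.IsSymm) (x : ι → ℝ) :
    x ⬝ᵥ (A *ᵥ x) =
      ∑ i, (∑ j, A i j) * x i ^ 2 - (1 / 2 : ℝ) * ∑ i, ∑ j, A i j * (x i - x j) ^ 2 := by
  have h1 : x ⬝ᵥ (A *ᵥ x) = ∑ i, ∑ j, A i j * (x i * x j) := by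
    simp only [dotProduct, mulVec, Finset.mul_sum]
    exact Finset.sum_congr rfl fun i _ => Finset.sum_congr rfl fun j _ => by ring
  have h2 : ∑ i, (∑ j, A i j) * x i ^ 2 = ∑ i, ∑ j, A i j * (x i * x i) := by
    refine Finset.sum_congr rfl fun i _ => ?_
    rw [Finset.sum_mul]
    exact Finset.sum_congr rfl fun j _ => by ring
  have h3 : ∑ i, ∑ j, A i j * (x j * x j) = ∑ i, ∑ j, A i j * (x i * x i) := by
    rw [Finset.sum_comm]
    exact Finset.sum_congr rfl fun i _ => Finset.sum_congr rfl fun j _ => by rw [hA.apply i j]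
  have h4 : ∑ i, ∑ j, A i j * (x i - x j) ^ 2 =
      ∑ i, ∑ j, A i j * (x i * x i) + ∑ i, ∑ j, A i j * (x j * x j)
        - 2 * ∑ i, ∑ j, A i j * (x i * x j) := by
    have e : ∀ i j, A i j * (x i - x j) ^ 2 =
        A i j * (x i * x i) + A i j * (x j * x j) - 2 * (A i j * (x i * x j)) := by
      intro i j; ring
    simp only [e, Finset.sum_sub_distrib, Finset.sum_add_distrib, Finset.mul_sum]
  rw [h1, h2, h4, h3]; ring

omit [DecidableEq ι] in
/-- EXACT derivative of the boundary-layer storage along a differentiable motion `s ↦ F · s`. [folklore] -/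
theorem hasDerivAt_W (γ : ℝ) (D : ι → ℝ) (F F' : ι → ℝ → ℝ) (t : ℝ)
    (hF : ∀ b, HasDerivAt (F b) (F' b t) t) :
    HasDerivAt (fun s => W γ D (fun b => F b s)) (γ * ∑ b, F b t * F' b t / D b) t := by
  unfold W
  have hb : ∀ b, HasDerivAt (fun s => F b s ^ 2 / (2 * D b)) (F b t * F' b t / D b) t := by
    intro b
    have h3 : HasDerivAt (fun s => F b s ^ 2 / (2 * D b))
        (((2 : ℕ) : ℝ) * F b t ^ (2 - 1) * F' b t / (2 * D b)) t :=
      ((hF b).pow 2).div_const (2 * D b)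
    refine h3.congr_deriv ?_
    rw [show (2 : ℕ) - 1 = 1 from rfl, pow_one]
    push_cast
    rw [mul_assoc, mul_div_mul_left _ _ (two_ne_zero)]
  have hs : HasDerivAt (fun s => ∑ b, F b s ^ 2 / (2 * D b)) (∑ b, F b t * F' b t / D b) t :=
    HasDerivAt.fun_sum (u := Finset.univ) (fun b _ => hb b)
  exact hs.const_mul γ

omit [DecidableEq ι] in
/-- With `Ḟ_b = -(S θ̇)_b` (chain rule on the mismatch) and `ν_b = F_b / D_b`, the exact derivative
of `W` is minus `γ` times the bilinear form `ν ↦ νᵀ S θ̇` — the card's `Ẇ = -γ νᵀ S_{b·} θ̇`. [folklore] -/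
theorem derivW_eq_neg_form (γ : ℝ) (D F F' θ' : ι → ℝ) (S : Matrix ι ι ℝ)
    (hF' : ∀ b, F' b = -(S *ᵥ θ') b) :
    γ * ∑ b, F b * F' b / D b = -(γ * ((fun b => F b / D b) ⬝ᵥ (S *ᵥ θ'))) := by
  rw [dotProduct, ← mul_neg, ← Finset.sum_neg_distrib]
  congr 1
  refine Finset.sum_congr rfl fun b _ => ?_
  rw [hF']
  ring

omit [DecidableEq ι] in
/-- `Σ_g M_g y_g = 0` for the COI-relative coordinates `y_g = x_g - (Σ_k M_k x_k) / (Σ_k M_k)`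
(total inertia nonzero): the identity that removes the damping/cross mixed term of the
Willems–Chiang storage under a UNIFORM damping rate. [folklore] -/
theorem coi_moment_zero (Mg x : ι → ℝ) (hM : ∑ k, Mg k ≠ 0) :
    ∑ g, Mg g * (x g - (∑ k, Mg k * x k) / ∑ k, Mg k) = 0 := by
  simp_rw [mul_sub, Finset.sum_sub_distrib, ← Finset.sum_mul]
  rw [mul_div_cancel₀ _ hM, sub_self]

/-- SERIES RULE of the private-fraction grounding recursion (support P2 of the card): a bus with
grounding budget `a` seen through an edge of stiffness `c` grounds its far end with the series
value `c a / (c + a)`:  `c (x - y)² + a y² ≥ (c a / (c + a)) x²` — it is the identity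
`(c + a)(c (x - y)² + a y²) - c a x² = (c (x - y) - a y)²`, so only `c + a > 0` is needed.
(The parallel rule is additivity.) [folklore] -/
theorem series_grounding (c a x y : ℝ) (hca : 0 < c + a) :
    c * a / (c + a) * x ^ 2 ≤ c * (x - y) ^ 2 + a * y ^ 2 := by
  rw [div_mul_eq_mul_div, div_le_iff₀ hca]
  nlinarith [sq_nonneg (c * (x - y) - a * y)]

/-- P2 rung (path case of the private-fraction grounding recursion used by `localrows.py`):
the accumulated grounding along a path `0 – 1 – … – n` with root grounding `g` and series
stiffnesses `c (i+1)` on edge `{i, i+1}`:  `a 0 = g`, `a (i+1) = c(i+1)·a(i) / (c(i+1) + a(i))`. [folklore] -/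
noncomputable def pathGround (g : ℝ) (c : ℕ → ℝ) : ℕ → ℝ
  | 0 => g
  | i + 1 => c (i + 1) * pathGround g c i / (c (i + 1) + pathGround g c i)

/-- The accumulated path grounding is positive (positive root grounding and stiffnesses). [folklore] -/
theorem pathGround_pos (g : ℝ) (c : ℕ → ℝ) (hg : 0 < g) (hc : ∀ i, 0 < c i) :
    ∀ n, 0 < pathGround g c n
  | 0 => by simpa [pathGround] using hg
  | n + 1 => by
    have ih := pathGround_pos g c hg hc n
    simp only [pathGround]
    exact div_pos (mul_pos (hc _) ih) (add_pos (hc _) ih)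

/-- PATH GROUNDING (matrix-free lower bound for a grounded path Laplacian, the building block of
the VALID simultaneous private-fraction groundings `L_bb ⪰ diag a` behind row R1):
`g·x₀² + Σ_{i<n} c(i+1)(x(i+1) − x(i))² ≥ a(n)·x(n)²`.  Induction on `n` with `series_grounding`. [folklore] -/
theorem path_grounding (g : ℝ) (c : ℕ → ℝ) (hg : 0 < g) (hc : ∀ i, 0 < c i) (x : ℕ → ℝ) :
    ∀ n, pathGround g c n * x n ^ 2 ≤
      g * x 0 ^ 2 + ∑ i ∈ Finset.range n, c (i + 1) * (x (i + 1) - x i) ^ 2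
  | 0 => by simp [pathGround]
  | n + 1 => by
    have ih := path_grounding g c hg hc x n
    have hpos := pathGround_pos g c hg hc n
    have hstep := series_grounding (c (n + 1)) (pathGround g c n) (x (n + 1)) (x n)
      (add_pos (hc _) hpos)
    rw [Finset.sum_range_succ]
    simp only [pathGround]
    linarith

end Summit.Ventures.GridStability.Lyapunov.BoundaryLayer
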